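import Mathlib.LinearAlgebra.Finsupp.LinearCombination
import Mathlib.LinearAlgebra.Dual.Lemmas
import Mathlib.RingTheory.Localization.Integer
import Mathlib.RingTheory.Localization.FractionRing
import Mathlib.Data.ENat.Lattice
import Literature.NumberTheory.Sieve.LinearEquationsInPrimesNormalForm
import HarnessLib

/-!
# Cauchy–Schwarz complexity of a system of affine-linear forms and its cluster-level variant

Trunk T-SIEVE (`Literature/NumberTheory/Sieve`), over the vocabulary of
`Literature/NumberTheory/Sieve/LinearEquationsInPrimes.lean` (`AffLinForm d`, systems
`Ψ : Fin t → AffLinForm d`, `IsFiniteComplexitySystem`).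

We formalise Definition 1.5 of B. Green, T. Tao, *Linear equations in primes*, Ann. of Math. 171
(2010) (arXiv:math/0606088, p. 5):

> "Let `Ψ = (ψ₁, …, ψ_t)` be a system of affine-linear forms. If `1 ≤ i ≤ t` and `s ≥ 0`, we say
> that `Ψ` has *`i`-complexity at most `s`* if one can cover the `t - 1` forms
> `{ψⱼ : j ∈ [t] ∖ {i}}` by `s + 1` classes, such that `ψᵢ` does not lie in the affine-linear
> span of any of these classes. The *complexity* of `Ψ` is defined to be the least `s` for which
> the system has `i`-complexity at most `s` for all `1 ≤ i ≤ t`, or `∞` if no such `s` exists."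

* `Literature.NumberTheory.Sieve.MemAffLinSpan Ψ i C` — "`ψᵢ` lies in the affine-linear span of
  the class `{ψⱼ : j ∈ C}`": `ψᵢ = ∑_{j ∈ C} cⱼ ψⱼ + c₀` as functions on `ℤ^d` with rational
  `cⱼ, c₀` (the span is over `ℚ`: Green–Tao's Examples 1 list the Sophie Germain system
  `(n, 2n + 1)` as having infinite complexity, and the witnesses `f_k` in the proof of Lemma 4.4
  live in `ℚ^d`). Proved characterisations: it is decided by the LINEAR PARTS
  (`memAffLinSpan_iff_coeff`: `ψ̇ᵢ = ∑ cⱼ ψ̇ⱼ` over `ℚ`; `memAffLinSpan_iff_mem_span`: `ψ̇ᵢ` lies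
  in the `ℚ`-`Submodule.span` of the `ψ̇ⱼ`), by an INTEGER relation
  (`memAffLinSpan_iff_exists_int`: `m ψ̇ᵢ = ∑ cⱼ ψ̇ⱼ` with `m ≠ 0`, all integers), and by
  WITNESSES as in the proof of Lemma 4.4 (`not_memAffLinSpan_iff_exists_witness`: `ψᵢ` is NOT in
  the span iff some `f ∈ ℤ^d` has `ψ̇ⱼ(f) = 0` for all `j ∈ C` and `ψ̇ᵢ(f) ≠ 0`).
* `Literature.NumberTheory.Sieve.HasAvoidingCover Ψ i P s` — the engine of Def. 1.5: the forms
  `ψⱼ` with `P j` can be covered by `s + 1` classes none of whose affine-linear spans contains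
  `ψᵢ`; `HasIComplexityLE Ψ i s` ("`i`-complexity `≤ s`") is the case `P j := (j ≠ i)`.
* `Literature.NumberTheory.Sieve.complexity Ψ : ℕ∞` — the complexity (Def. 1.5), with
  `complexity_le_coe_iff : complexity Ψ ≤ s ↔ ∀ i, HasIComplexityLE Ψ i s`.
* CLUSTER LEVEL. Two forms are *parallel* (`AffLinForm.IsParallel`) when their linear parts are
  rationally dependent (`a ψ̇ = b ψ̇'`, `(a, b) ≠ (0, 0)`); `IsFiniteComplexitySystem Ψ` is
  literally "no two distinct forms parallel" (`isFiniteComplexitySystem_iff_not_isParallel`). The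
  parallel classes of a system ("clusters": the twin pair `(n, n + 2)`, a prime `k`-tuple
  `(n + h₁, …, n + h_k)`, …) are the atoms of an infinite-complexity system; the complexity of
  their CONFIGURATION is `Literature.NumberTheory.Sieve.clusterComplexity Ψ : ℕ∞`, defined exactly
  as `complexity` except that, for each `i`, only the forms NOT parallel to `ψᵢ` have to be covered
  (`HasClusterIComplexityLE Ψ i s` is the case `P j := ¬ ψᵢ ∥ ψⱼ` of the engine). Equivalently it
  is the complexity of any transversal of the parallel classes (one form per cluster), since
  membership in an affine-linear span only depends on the lines `ℚ ψ̇ⱼ`. Always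
  `clusterComplexity Ψ ≤ complexity Ψ`, with equality for systems of finite complexity.
* `Literature.NumberTheory.Sieve.ClusterGapLE Ψ B` ("cluster gap `≤ B`") — bounded internal gaps
  of the parallel classes: `|a ψᵢ(0) - b ψⱼ(0)| ≤ B (|a| + |b|)` whenever `a ψ̇ᵢ = b ψ̇ⱼ` with
  `(a, b) ≠ (0, 0)` (twin/`k`-tuple/Sophie Germain clusters have bounded gap; the Goldbach pair
  `(n, M - n)` has gap `≍ M`).
* Lemma 1.6: `complexity Ψ < ⊤ ↔ IsFiniteComplexitySystem Ψ ∧ ∀ i, ψ̇ᵢ ≠ 0`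
  (`complexity_lt_top_iff`), and in that case `complexity Ψ ≤ t - 2` (the singleton cover,
  `complexity_le_of_isFiniteComplexitySystem`) and indeed `complexity Ψ ≤ t - dim Ψ̇`
  (`complexity_le_sub_linearRank`, `linearRank Ψ = dim Ψ̇`); the pigeonhole lower bound
  `not_hasAvoidingCover_of_pairs` used to compute complexities exactly; `d = 1 ⇒` every two forms
  are parallel, `clusterComplexity Ψ = 0` and (for `t ≥ 2`) `complexity Ψ = ⊤`.
* TRANSVERSALS (`clusterComplexity_eq_complexity_of_labels`): if every form of `Ψ` is
  proportional to the form `φ_{cl j}` of a system `Φ` with no two forms parallel (`cl` onto),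
  then `clusterComplexity Ψ = complexity Φ` — the cluster complexity IS the complexity of the
  configuration of clusters; and the two-class rendering of "cluster complexity `≤ 1`" used by
  the route (`hasClusterIComplexityLE_one_iff`).
* The bridge from Green–Tao's `s`-normal form (`complexity_le_of_isNormalForm`:
  `IsNormalForm s Ψ →` (non-constant forms) `→ complexity Ψ ≤ s`, §4 after Def. 4.2).
* Worked examples: `k`-term progressions have complexity `k - 2` (GT Examples 1,
  `complexity_arithProg`, stated for `k + 2` forms); twin primes (`complexity = ⊤`,
  `clusterComplexity = 0`, gap `≤ 1`); the Schur configuration `(n₁, n₂, n₁ + n₂)`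
  (complexity `1`) and the route's corner system `(n₁, n₁+2, n₂, n₂+2, n₁+n₂, n₁+n₂+2)`
  (`clusterComplexity = 1`, gap `≤ 1`, `complexity = ⊤`); four-term progressions of twins
  (`clusterComplexity = 2`); shift pairs `(n, n + h)` (gap `≤ B ↔ |h| ≤ 2B`) and the Goldbach
  pair `(n, M - n)` (gap `> B` once `|M| > 2B`).

Mathlib (pinned) has the linear algebra used here (`Submodule.span`,
`Submodule.exists_dual_map_eq_bot_of_notMem`, `IsLocalization.exist_integer_multiples`, `ℕ∞`)
but no notion of (Cauchy–Schwarz) complexity of a system of linear or affine-linear forms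
(searched `complexity`, `affine.*span`, `IsParallel`); the tree had only
`IsFiniteComplexitySystem` ("no two linear parts parallel") and `IsNormalForm` (Def. 4.2).

## Design choices

* Classes are `Finset (Fin t)`, a cover by `s + 1` classes is a map `Fin (s + 1) → Finset (Fin t)`
  (repetitions and empty classes allowed, so "at most `s + 1` classes" and "exactly `s + 1`"
  agree, and so do covers and partitions — GT's Remark after Def. 1.5 — since sub-classes of an
  avoiding class are avoiding, `MemAffLinSpan.mono`). A class containing `i` itself, or a form
  parallel to a non-constant `ψᵢ`, is never avoiding, so it is harmless to let classes range over
  all of `Fin t`.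
* A CONSTANT form `ψᵢ` (`ψ̇ᵢ = 0`) lies in the affine-linear span of every class (even the empty
  one), so a system with a constant form has `complexity = clusterComplexity = ⊤`; Green–Tao
  exclude constant forms throughout (Def. 1.1), and `IsNondegenerateSystem` does so in the tree.
* `ℕ∞`-valued complexities are least levels of a monotone property (`leastLevel`), an `iInf` in
  the complete lattice `ℕ∞`; `⊤` renders "`∞`".
* The cluster-level notions are this tree's bookkeeping for the infinite-complexity regime
  (route `TwinMinorArcs` of `Summits/Parity/GeneralizedHardyLittlewood`): they are literally
  Def. 1.5 applied to the configuration of parallel classes, tagged `[folklore]`.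
* `k`-term progressions: the system `(n₁, n₁ + n₂, …, n₁ + (k-1) n₂)` is written as the lambda
  `fun i : Fin k => ⟨![1, i], 0⟩`, definitionally the tree's `Literature.Barriers.Parity.apSystem k`
  (not imported here: that file carries the singular-series estimates of the barrier catalogue).
* NOT here: Lemma 4.4 itself (existence of normal-form extensions; see
  `LinearEquationsInPrimesNormalFormExtension.lean` for the finite-complexity instance).

## References

* B. Green, T. Tao, *Linear equations in primes*, Ann. of Math. (2) 171 (2010), 1753–1850
  (arXiv:math/0606088): Def. 1.1, Def. 1.5 and the Remark and Examples 1 following it, Lemma 1.6,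
  §4 (Def. 4.2, proof of Lemma 4.4: the witnesses `f_k`).
-/

noncomputable section

open Finset

namespace Literature.NumberTheory.Sieve

variable {d t : ℕ}

/-! ### Parallel forms -/

namespace AffLinForm

/-- `ψ(e_k) = ψ̇(e_k) + ψ(0)`. [cite: GreenTao2010, Def. 1.1] -/
theorem eval_single (ψ : AffLinForm d) (k : Fin d) :
    ψ.eval (Pi.single k 1) = ψ.coeff k + ψ.const := by
  rw [eval_eq_linearPart_add_const, linearPart_single]

/-- Two affine-linear forms are *parallel* when their linear parts are rationally dependent:
`a ψ̇ = b ψ̇'` for some integers `(a, b) ≠ (0, 0)` (for non-constant forms: the lines `ℚ ψ̇` and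
`ℚ ψ̇'` coincide; a constant form is parallel to every form). This is the negation of the
pairwise condition in `IsFiniteComplexitySystem`. [cite: GreenTao2010, Def. 1.1 and Lemma 1.6] -/
def IsParallel (ψ ψ' : AffLinForm d) : Prop :=
  ∃ a b : ℤ, (a ≠ 0 ∨ b ≠ 0) ∧ a • ψ.coeff = b • ψ'.coeff

/-- Every form is parallel to itself. [folklore] -/
theorem IsParallel.refl (ψ : AffLinForm d) : ψ.IsParallel ψ := ⟨1, 1, Or.inl one_ne_zero, rfl⟩

/-- Parallelism is symmetric. [folklore] -/
theorem IsParallel.symm {ψ ψ' : AffLinForm d} (h : ψ.IsParallel ψ') : ψ'.IsParallel ψ := by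
  obtain ⟨a, b, hab, h⟩ := h
  exact ⟨b, a, hab.symm, h.symm⟩

/-- Not parallel, spelled out: every relation `a ψ̇ = b ψ̇'` is trivial (the pairwise condition
of `IsFiniteComplexitySystem`). [cite: GreenTao2010, Def. 1.1] -/
theorem not_isParallel_iff {ψ ψ' : AffLinForm d} :
    ¬ ψ.IsParallel ψ' ↔ ∀ a b : ℤ, a • ψ.coeff = b • ψ'.coeff → a = 0 ∧ b = 0 := by
  simp only [IsParallel, not_exists, not_and]
  refine forall₂_congr fun a b => ⟨fun h heq => ?_, fun h hab heq => ?_⟩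
  · by_contra hne
    exact h (not_and_or.mp hne) heq
  · obtain ⟨rfl, rfl⟩ := h heq
    simp at hab

/-- A constant form is parallel to every form. [folklore] -/
theorem isParallel_of_coeff_eq_zero {ψ : AffLinForm d} (h : ψ.coeff = 0) (ψ' : AffLinForm d) :
    ψ.IsParallel ψ' :=
  ⟨1, 0, Or.inl one_ne_zero, by simp [h]⟩

/-- In dimension `d = 1` every two forms are parallel. [cite: GreenTao2010, Examples 1] -/
theorem isParallel_of_dim_one (ψ ψ' : AffLinForm 1) : ψ.IsParallel ψ' := by
  by_cases h : ψ.coeff 0 = 0 ∧ ψ'.coeff 0 = 0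
  · refine ⟨1, 1, Or.inl one_ne_zero, funext fun k => ?_⟩
    fin_cases k
    simp [h.1, h.2]
  · refine ⟨ψ'.coeff 0, ψ.coeff 0, ?_, funext fun k => ?_⟩
    · tauto
    · fin_cases k
      simp [mul_comm]

end AffLinForm

/-- `IsFiniteComplexitySystem Ψ` says exactly that no two distinct forms of `Ψ` are parallel.
[cite: GreenTao2010, Lemma 1.6] -/
theorem isFiniteComplexitySystem_iff_not_isParallel {Ψ : Fin t → AffLinForm d} :
    IsFiniteComplexitySystem Ψ ↔ ∀ i j, i ≠ j → ¬ (Ψ i).IsParallel (Ψ j) :=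
  forall₃_congr fun _ _ _ => AffLinForm.not_isParallel_iff.symm

/-! ### Affine-linear spans of classes of forms -/

/-- "`ψᵢ` lies in the affine-linear span of the forms `{ψⱼ : j ∈ C}`": there are rationals
`cⱼ (j ∈ C)` and `c₀` with `ψᵢ(n) = ∑_{j ∈ C} cⱼ ψⱼ(n) + c₀` for every `n ∈ ℤ^d`.
[cite: GreenTao2010, Def. 1.5] -/
def MemAffLinSpan (Ψ : Fin t → AffLinForm d) (i : Fin t) (C : Finset (Fin t)) : Prop :=
  ∃ (c : Fin t → ℚ) (c₀ : ℚ), ∀ n : Fin d → ℤ,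
    (((Ψ i).eval n : ℤ) : ℚ) = ∑ j ∈ C, c j * (((Ψ j).eval n : ℤ) : ℚ) + c₀

variable {Ψ : Fin t → AffLinForm d} {i : Fin t} {C : Finset (Fin t)}

/-- Membership in an affine-linear span is decided by the linear parts: `ψᵢ` lies in the
affine-linear span of `{ψⱼ : j ∈ C}` iff `ψ̇ᵢ = ∑_{j ∈ C} cⱼ ψ̇ⱼ` for some rationals `cⱼ`
(evaluate at `0` and at the basis vectors; conversely adjust the constant).
[cite: GreenTao2010, Def. 1.5 and proof of Lemma 4.4] -/
theorem memAffLinSpan_iff_coeff :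
    MemAffLinSpan Ψ i C ↔
      ∃ c : Fin t → ℚ, ∀ k : Fin d, ((Ψ i).coeff k : ℚ) = ∑ j ∈ C, c j * ((Ψ j).coeff k : ℚ) := by
  constructor
  · rintro ⟨c, c₀, h⟩
    refine ⟨c, fun k => ?_⟩
    have hk := h (Pi.single k 1)
    have h0 := h 0
    simp only [AffLinForm.eval_single, AffLinForm.eval_zero, Int.cast_add, mul_add,
      Finset.sum_add_distrib] at hk h0
    linarith
  · rintro ⟨c, hc⟩
    refine ⟨c, (Ψ i).const - ∑ j ∈ C, c j * (Ψ j).const, fun n => ?_⟩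
    have key : ∀ ψ : AffLinForm d,
        ((ψ.eval n : ℤ) : ℚ) = ∑ k, (ψ.coeff k : ℚ) * n k + ψ.const := by
      intro ψ
      simp [AffLinForm.eval]
    have hsum : ∑ k, ((Ψ i).coeff k : ℚ) * n k
        = ∑ j ∈ C, c j * ∑ k, ((Ψ j).coeff k : ℚ) * n k :=
      calc ∑ k, ((Ψ i).coeff k : ℚ) * n k
          = ∑ k, ∑ j ∈ C, c j * (((Ψ j).coeff k : ℚ) * n k) := by
            refine Finset.sum_congr rfl fun k _ => ?_
            rw [hc k, Finset.sum_mul]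
            exact Finset.sum_congr rfl fun j _ => by ring
        _ = ∑ j ∈ C, c j * ∑ k, ((Ψ j).coeff k : ℚ) * n k := by
            rw [Finset.sum_comm]
            exact Finset.sum_congr rfl fun j _ => by rw [Finset.mul_sum]
    simp only [key, hsum, mul_add, Finset.sum_add_distrib]
    ring

/-- Integer form: `ψᵢ` lies in the affine-linear span of `{ψⱼ : j ∈ C}` iff some NON-ZERO
integer multiple of `ψ̇ᵢ` is an integer combination of the `ψ̇ⱼ`, `j ∈ C` (clear denominators).
[cite: GreenTao2010, Def. 1.5 and proof of Lemma 4.4] -/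
theorem memAffLinSpan_iff_exists_int :
    MemAffLinSpan Ψ i C ↔
      ∃ (m : ℤ) (c : Fin t → ℤ), m ≠ 0 ∧ m • (Ψ i).coeff = ∑ j ∈ C, c j • (Ψ j).coeff := by
  rw [memAffLinSpan_iff_coeff]
  constructor
  · rintro ⟨c, hc⟩
    obtain ⟨⟨b, hb⟩, hint⟩ := IsLocalization.exist_integer_multiples (nonZeroDivisors ℤ) C c
    simp only [IsLocalization.IsInteger, RingHom.mem_rangeS, eq_intCast, zsmul_eq_mul] at hint
    choose! z hz using hint
    refine ⟨b, z, nonZeroDivisors.ne_zero hb, funext fun k => ?_⟩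
    simp only [Pi.smul_apply, smul_eq_mul, Finset.sum_apply]
    have : ((b * (Ψ i).coeff k : ℤ) : ℚ) = ((∑ j ∈ C, z j * (Ψ j).coeff k : ℤ) : ℚ) := by
      push_cast
      rw [hc k, Finset.mul_sum]
      refine Finset.sum_congr rfl fun j hj => ?_
      rw [hz j hj]
      ring
    exact_mod_cast this
  · rintro ⟨m, c, hm, h⟩
    refine ⟨fun j => c j / m, fun k => ?_⟩
    have hk := congr_fun h k
    simp only [Pi.smul_apply, smul_eq_mul, Finset.sum_apply] at hk
    have hm' : (m : ℚ) ≠ 0 := by exact_mod_cast hm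
    have hk' : (m : ℚ) * (Ψ i).coeff k = ∑ j ∈ C, (c j : ℚ) * (Ψ j).coeff k := by
      exact_mod_cast hk
    calc ((Ψ i).coeff k : ℚ) = (m : ℚ)⁻¹ * ((m : ℚ) * (Ψ i).coeff k) :=
          (inv_mul_cancel_left₀ hm' _).symm
      _ = ∑ j ∈ C, c j / m * ((Ψ j).coeff k : ℚ) := by
          rw [hk', Finset.mul_sum]
          exact Finset.sum_congr rfl fun j _ => by ring

/-- Bridge to Mathlib: `ψᵢ` lies in the affine-linear span of `{ψⱼ : j ∈ C}` iff its rational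
coefficient vector lies in the `ℚ`-span (`Submodule.span`) of theirs. [cite: GreenTao2010, Def. 1.5] -/
theorem memAffLinSpan_iff_mem_span :
    MemAffLinSpan Ψ i C ↔
      (fun k => ((Ψ i).coeff k : ℚ)) ∈
        Submodule.span ℚ ((fun j : Fin t => fun k => ((Ψ j).coeff k : ℚ)) '' ↑C) := by
  rw [memAffLinSpan_iff_coeff, Submodule.mem_span_image_finset_iff_exists_fun]
  constructor
  · rintro ⟨c, hc⟩
    refine ⟨fun j => c j, funext fun k => ?_⟩
    simp only [Finset.sum_apply, Pi.smul_apply, smul_eq_mul]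
    rw [hc k, ← Finset.sum_coe_sort C]
  · rintro ⟨c, hc⟩
    classical
    refine ⟨fun j => if h : j ∈ C then c ⟨j, h⟩ else 0, fun k => ?_⟩
    have := congr_fun hc k
    simp only [Finset.sum_apply, Pi.smul_apply, smul_eq_mul] at this
    rw [← this, ← Finset.sum_coe_sort C]
    exact Finset.sum_congr rfl fun j _ => by simp only [dif_pos j.2, Subtype.coe_eta]

/-- Sub-classes: if `ψᵢ` is in the affine-linear span of a class, it is in that of every larger
class (so covers and partitions give the same notion of complexity).
[cite: GreenTao2010, Remark after Def. 1.5] -/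
theorem MemAffLinSpan.mono {C' : Finset (Fin t)} (h : MemAffLinSpan Ψ i C) (hCC' : C ⊆ C') :
    MemAffLinSpan Ψ i C' := by
  classical
  obtain ⟨c, c₀, hc⟩ := h
  refine ⟨fun j => if j ∈ C then c j else 0, c₀, fun n => ?_⟩
  rw [hc n, ← Finset.sum_subset hCC' (fun _ _ hj => by simp [hj])]
  congr 1
  exact Finset.sum_congr rfl fun j hj => by simp [hj]

/-- A constant form lies in the affine-linear span of every class (even the empty one).
[cite: GreenTao2010, Def. 1.1] -/
theorem memAffLinSpan_of_coeff_eq_zero (h : (Ψ i).coeff = 0) (C : Finset (Fin t)) :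
    MemAffLinSpan Ψ i C :=
  ⟨0, (Ψ i).const, fun n => by simp [AffLinForm.eval, h]⟩

/-- The affine-linear span of the empty class consists of the constants. [folklore] -/
theorem memAffLinSpan_empty_iff : MemAffLinSpan Ψ i ∅ ↔ (Ψ i).coeff = 0 := by
  refine ⟨fun h => ?_, fun h => memAffLinSpan_of_coeff_eq_zero h ∅⟩
  obtain ⟨m, c, hm, h⟩ := memAffLinSpan_iff_exists_int.mp h
  rw [Finset.sum_empty] at h
  exact (smul_eq_zero.mp h).resolve_left hm

/-- A form lies in the affine-linear span of any class containing it. [folklore] -/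
theorem memAffLinSpan_of_mem (h : i ∈ C) : MemAffLinSpan Ψ i C := by
  classical
  refine memAffLinSpan_iff_exists_int.mpr ⟨1, fun j => if j = i then 1 else 0, one_ne_zero, ?_⟩
  simp [Finset.sum_ite_eq', h]

/-- A form parallel to a NON-CONSTANT member of a class lies in the affine-linear span of the
class. [cite: GreenTao2010, proof of Lemma 1.6] -/
theorem memAffLinSpan_of_isParallel {j : Fin t} (hj : j ∈ C) (hpar : (Ψ i).IsParallel (Ψ j))
    (h0 : (Ψ j).coeff ≠ 0) : MemAffLinSpan Ψ i C := by
  classical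
  obtain ⟨a, b, hab, heq⟩ := hpar
  have ha : a ≠ 0 := by
    rintro rfl
    rw [zero_smul, eq_comm, smul_eq_zero] at heq
    tauto
  refine (memAffLinSpan_iff_exists_int.mpr ⟨a, fun l => if l = j then b else 0, ha, ?_⟩).mono
    (Finset.singleton_subset_iff.mpr hj)
  simp [heq]

/-- WITNESSES (Green–Tao, proof of Lemma 4.4): if some `f ∈ ℤ^d` has `ψ̇ⱼ(f) = 0` for all
`j ∈ C` but `ψ̇ᵢ(f) ≠ 0`, then `ψᵢ` is not in the affine-linear span of the class.
[cite: GreenTao2010, proof of Lemma 4.4] -/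
theorem not_memAffLinSpan_of_witness (f : Fin d → ℤ) (hC : ∀ j ∈ C, (Ψ j).linearPart f = 0)
    (hi : (Ψ i).linearPart f ≠ 0) : ¬ MemAffLinSpan Ψ i C := by
  rw [memAffLinSpan_iff_exists_int]
  rintro ⟨m, c, hm, h⟩
  have key := congrArg (fun v : Fin d → ℤ => ∑ k, v k * f k) h
  simp only [Pi.smul_apply, smul_eq_mul, Finset.sum_apply, Finset.sum_mul] at key
  rw [Finset.sum_comm] at key
  have h1 : ∑ k, m * (Ψ i).coeff k * f k = m * (Ψ i).linearPart f := by
    simp only [AffLinForm.linearPart, Finset.mul_sum]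
    exact Finset.sum_congr rfl fun k _ => by ring
  have h2 : ∑ j ∈ C, ∑ k, c j * (Ψ j).coeff k * f k = 0 := by
    refine Finset.sum_eq_zero fun j hj => ?_
    have : ∑ k, c j * (Ψ j).coeff k * f k = c j * (Ψ j).linearPart f := by
      simp only [AffLinForm.linearPart, Finset.mul_sum]
      exact Finset.sum_congr rfl fun k _ => by ring
    rw [this, hC j hj, mul_zero]
  rw [h1, h2] at key
  exact hi ((mul_eq_zero.mp key).resolve_left hm)

/-- Conversely, a form outside the affine-linear span of a class admits an integer witness
(duality over `ℚ`, then clear denominators); together: `ψᵢ` is NOT in the affine-linear span of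
`{ψⱼ : j ∈ C}` iff some `f ∈ ℤ^d` has `ψ̇ⱼ(f) = 0` (`j ∈ C`) and `ψ̇ᵢ(f) ≠ 0`.
[cite: GreenTao2010, proof of Lemma 4.4] -/
theorem not_memAffLinSpan_iff_exists_witness :
    ¬ MemAffLinSpan Ψ i C ↔
      ∃ f : Fin d → ℤ, (∀ j ∈ C, (Ψ j).linearPart f = 0) ∧ (Ψ i).linearPart f ≠ 0 := by
  refine ⟨fun h => ?_, fun ⟨f, hC, hi⟩ => not_memAffLinSpan_of_witness f hC hi⟩
  rw [memAffLinSpan_iff_mem_span] at h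
  set v : Fin t → Fin d → ℚ := fun j k => ((Ψ j).coeff k : ℚ) with hv
  obtain ⟨φ, hφi, hφC⟩ := Submodule.exists_dual_map_eq_bot_of_notMem h inferInstance
  have hC0 : ∀ j ∈ C, φ (v j) = 0 := fun j hj => by
    have : φ (v j) ∈ (Submodule.span ℚ (v '' ↑C)).map φ :=
      Submodule.mem_map_of_mem (Submodule.subset_span ⟨j, hj, rfl⟩)
    rwa [hφC, Submodule.mem_bot] at this
  -- represent `φ` by the vector `g k = φ(e_k)`
  set g : Fin d → ℚ := fun k => φ (Pi.single k 1) with hg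
  have hrep : ∀ w : Fin d → ℚ, φ w = ∑ k, w k * g k := fun w => by
    conv_lhs => rw [← Finset.univ_sum_single w]
    rw [map_sum]
    refine Finset.sum_congr rfl fun k _ => ?_
    rw [show (Pi.single k (w k) : Fin d → ℚ) = w k • Pi.single k (1 : ℚ) by
      rw [← Pi.single_smul, smul_eq_mul, mul_one], map_smul, smul_eq_mul]
  -- clear the denominators of `g`
  obtain ⟨⟨b, hb⟩, hint⟩ :=
    IsLocalization.exist_integer_multiples (nonZeroDivisors ℤ) (Finset.univ : Finset (Fin d)) g
  simp only [IsLocalization.IsInteger, RingHom.mem_rangeS, eq_intCast, zsmul_eq_mul] at hint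
  choose! f hf using hint
  have hlin : ∀ ψ : AffLinForm d, ((ψ.linearPart f : ℤ) : ℚ) = b * φ (fun k => (ψ.coeff k : ℚ)) :=
    fun ψ => by
      simp only [AffLinForm.linearPart, Int.cast_sum, Int.cast_mul, hrep, Finset.mul_sum]
      exact Finset.sum_congr rfl fun k _ => by rw [hf k (Finset.mem_univ k)]; ring
  refine ⟨f, fun j hj => ?_, fun h0 => ?_⟩
  · have : (((Ψ j).linearPart f : ℤ) : ℚ) = 0 := by rw [hlin, hC0 j hj, mul_zero]
    exact_mod_cast this
  · have h1 := hlin (Ψ i)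
    rw [h0, Int.cast_zero, eq_comm, mul_eq_zero] at h1
    have hb' : (b : ℚ) ≠ 0 := by exact_mod_cast nonZeroDivisors.ne_zero hb
    exact hφi (h1.resolve_left hb')

/-! ### Covers by avoiding classes; `i`-complexity (Def. 1.5) -/

/-- The engine of Def. 1.5: the forms `ψⱼ` with `P j` can be covered by `s + 1` classes
`A₀, …, A_s` such that `ψᵢ` lies in the affine-linear span of none of the classes.
[cite: GreenTao2010, Def. 1.5] -/
def HasAvoidingCover (Ψ : Fin t → AffLinForm d) (i : Fin t) (P : Fin t → Prop) (s : ℕ) : Prop :=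
  ∃ A : Fin (s + 1) → Finset (Fin t), (∀ j, P j → ∃ k, j ∈ A k) ∧ ∀ k, ¬ MemAffLinSpan Ψ i (A k)

/-- **`i`-complexity at most `s`** (Green–Tao 2010, Def. 1.5): the `t - 1` forms `ψⱼ`, `j ≠ i`,
can be covered by `s + 1` classes such that `ψᵢ` does not lie in the affine-linear span of any of
them. [cite: GreenTao2010, Def. 1.5] -/
abbrev HasIComplexityLE (Ψ : Fin t → AffLinForm d) (i : Fin t) (s : ℕ) : Prop :=
  HasAvoidingCover Ψ i (fun j => j ≠ i) s

/-- **Cluster-level `i`-complexity at most `s`**: the forms NOT PARALLEL to `ψᵢ` can be covered by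
`s + 1` classes such that `ψᵢ` does not lie in the affine-linear span of any of them (Def. 1.5
applied to the configuration of parallel classes). [folklore] -/
abbrev HasClusterIComplexityLE (Ψ : Fin t → AffLinForm d) (i : Fin t) (s : ℕ) : Prop :=
  HasAvoidingCover Ψ i (fun j => ¬ (Ψ i).IsParallel (Ψ j)) s

variable {P : Fin t → Prop} {s : ℕ}

/-- More classes may be used (repeat one). [cite: GreenTao2010, Def. 1.5] -/
theorem HasAvoidingCover.mono {s' : ℕ} (h : HasAvoidingCover Ψ i P s) (hs : s ≤ s') :
    HasAvoidingCover Ψ i P s' := by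
  obtain ⟨A, hcov, hav⟩ := h
  refine ⟨fun k => A ⟨min k s, by omega⟩, fun j hj => ?_, fun k => hav _⟩
  obtain ⟨k, hk⟩ := hcov j hj
  refine ⟨Fin.castLE (by omega) k, ?_⟩
  have hk2 := k.2
  convert hk using 2
  ext
  simp only [Fin.val_castLE]
  omega

/-- Fewer forms to cover is easier. [folklore] -/
theorem HasAvoidingCover.anti {P' : Fin t → Prop} (h : HasAvoidingCover Ψ i P s)
    (hP : ∀ j, P' j → P j) : HasAvoidingCover Ψ i P' s := by
  obtain ⟨A, hcov, hav⟩ := h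
  exact ⟨A, fun j hj => hcov j (hP j hj), hav⟩

/-- A form with an avoiding cover is non-constant. [cite: GreenTao2010, Def. 1.1] -/
theorem HasAvoidingCover.coeff_ne_zero (h : HasAvoidingCover Ψ i P s) : (Ψ i).coeff ≠ 0 :=
  fun h0 => by
    obtain ⟨A, -, hav⟩ := h
    exact hav 0 (memAffLinSpan_of_coeff_eq_zero h0 _)

/-- No form of an avoiding class is `ψᵢ` itself, nor a non-constant form parallel to `ψᵢ`.
[cite: GreenTao2010, proof of Lemma 1.6] -/
theorem HasAvoidingCover.not_isParallel (h : HasAvoidingCover Ψ i P s) {j : Fin t} (hj : P j)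
    (h0 : (Ψ j).coeff ≠ 0) : ¬ (Ψ i).IsParallel (Ψ j) := fun hpar => by
  obtain ⟨A, hcov, hav⟩ := h
  obtain ⟨k, hk⟩ := hcov j hj
  exact hav k (memAffLinSpan_of_isParallel hk hpar h0)

/-- `i`-complexity `≤ s` implies cluster-level `i`-complexity `≤ s` (a form not parallel to `ψᵢ`
is in particular `≠ ψᵢ`). [folklore] -/
theorem HasIComplexityLE.hasClusterIComplexityLE (h : HasIComplexityLE Ψ i s) :
    HasClusterIComplexityLE Ψ i s :=
  h.anti fun _ hj hji => hj (hji ▸ AffLinForm.IsParallel.refl _)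

/-- PIGEONHOLE lower bound: if `s + 2` of the forms to be covered are such that `ψᵢ` lies in the
affine-linear span of ANY two of them, then `s + 1` avoiding classes do not suffice.
[cite: GreenTao2010, Examples 1] -/
theorem not_hasAvoidingCover_of_pairs (g : Fin (s + 2) → Fin t) (hg : ∀ a, P (g a))
    (hpair : ∀ a b, a ≠ b → MemAffLinSpan Ψ i {g a, g b}) : ¬ HasAvoidingCover Ψ i P s := by
  rintro ⟨A, hcov, hav⟩
  choose k hk using fun a => hcov (g a) (hg a)
  obtain ⟨a, b, hab, hk'⟩ := Fintype.exists_ne_map_eq_of_card_lt k (by simp)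
  refine hav (k a) ((hpair a b hab).mono fun x hx => ?_)
  simp only [Finset.mem_insert, Finset.mem_singleton] at hx
  rcases hx with rfl | rfl
  · exact hk a
  · rw [hk']; exact hk b

/-! ### Complexity and cluster complexity (`ℕ∞`-valued) -/

/-- The least `s : ℕ` with `Q s`, as an element of `ℕ∞` (`⊤` if there is none). [folklore] -/
def leastLevel (Q : ℕ → Prop) : ℕ∞ := ⨅ (s : ℕ) (_ : Q s), (s : ℕ∞)

variable {Q : ℕ → Prop}

/-- Any level satisfying `Q` bounds the least one. [folklore] -/
theorem leastLevel_le_coe (h : Q s) : leastLevel Q ≤ s := iInf₂_le s h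

/-- For a monotone property, `leastLevel Q ≤ s ↔ Q s`. [folklore] -/
theorem leastLevel_le_coe_iff (hQ : ∀ ⦃a b : ℕ⦄, a ≤ b → Q a → Q b) :
    leastLevel Q ≤ s ↔ Q s := by
  refine ⟨fun h => ?_, leastLevel_le_coe⟩
  by_contra hs
  have key : ((s + 1 : ℕ) : ℕ∞) ≤ leastLevel Q := by
    refine le_iInf₂ fun a ha => ?_
    have : s < a := lt_of_not_ge fun hle => hs (hQ hle ha)
    exact_mod_cast this
  have := key.trans h
  norm_cast at this
  omega

/-- `leastLevel Q = ⊤` iff no level satisfies `Q`. [folklore] -/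
theorem leastLevel_eq_top_iff : leastLevel Q = ⊤ ↔ ∀ s, ¬ Q s := by
  simp [leastLevel, iInf_eq_top]

/-- `leastLevel Q < ⊤` iff some level satisfies `Q`. [folklore] -/
theorem leastLevel_lt_top_iff : leastLevel Q < ⊤ ↔ ∃ s, Q s := by
  rw [lt_top_iff_ne_top, Ne, leastLevel_eq_top_iff]
  push Not
  rfl

/-- Lower bounds: `s ≤ leastLevel Q` iff every level satisfying `Q` is `≥ s`. [folklore] -/
theorem coe_le_leastLevel_iff : (s : ℕ∞) ≤ leastLevel Q ↔ ∀ s', Q s' → s ≤ s' := by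
  simp [leastLevel, le_iInf_iff]

/-- Exact value of a least level (monotone `Q`). [folklore] -/
theorem leastLevel_eq_coe_iff (hQ : ∀ ⦃a b : ℕ⦄, a ≤ b → Q a → Q b) :
    leastLevel Q = s ↔ Q s ∧ ∀ s', Q s' → s ≤ s' := by
  rw [le_antisymm_iff, leastLevel_le_coe_iff hQ, coe_le_leastLevel_iff]

/-- Monotonicity of least levels in the property. [folklore] -/
theorem leastLevel_mono {Q' : ℕ → Prop} (h : ∀ s, Q s → Q' s) : leastLevel Q' ≤ leastLevel Q :=
  le_iInf₂ fun s hs => iInf₂_le s (h s hs)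

/-- **Complexity** of a system of affine-linear forms (Green–Tao 2010, Def. 1.5): the least `s`
such that `Ψ` has `i`-complexity at most `s` for every `i`, or `⊤ = ∞` if there is none.
[cite: GreenTao2010, Def. 1.5] -/
def complexity (Ψ : Fin t → AffLinForm d) : ℕ∞ :=
  leastLevel fun s => ∀ i, HasIComplexityLE Ψ i s

/-- **Cluster complexity**: the least `s` such that `Ψ` has cluster-level `i`-complexity at most
`s` for every `i` (for each `i`, the forms not parallel to `ψᵢ` are covered by `s + 1` classes
whose affine-linear spans avoid `ψᵢ`), or `⊤` if there is none — the Cauchy–Schwarz complexity of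
the configuration of parallel classes ("clusters") of `Ψ`. [folklore] -/
def clusterComplexity (Ψ : Fin t → AffLinForm d) : ℕ∞ :=
  leastLevel fun s => ∀ i, HasClusterIComplexityLE Ψ i s

/-- `complexity Ψ ≤ s` iff every `i`-complexity is `≤ s`. [cite: GreenTao2010, Def. 1.5] -/
theorem complexity_le_coe_iff : complexity Ψ ≤ s ↔ ∀ i, HasIComplexityLE Ψ i s :=
  leastLevel_le_coe_iff fun _ _ hab h i => (h i).mono hab

/-- `clusterComplexity Ψ ≤ s` iff every cluster-level `i`-complexity is `≤ s`. [folklore] -/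
theorem clusterComplexity_le_coe_iff :
    clusterComplexity Ψ ≤ s ↔ ∀ i, HasClusterIComplexityLE Ψ i s :=
  leastLevel_le_coe_iff fun _ _ hab h i => (h i).mono hab

/-- Exact value of the complexity. [cite: GreenTao2010, Def. 1.5] -/
theorem complexity_eq_coe_iff : complexity Ψ = s ↔
    (∀ i, HasIComplexityLE Ψ i s) ∧ ∀ s', (∀ i, HasIComplexityLE Ψ i s') → s ≤ s' :=
  leastLevel_eq_coe_iff fun _ _ hab h i => (h i).mono hab

/-- Exact value of the cluster complexity. [folklore] -/
theorem clusterComplexity_eq_coe_iff : clusterComplexity Ψ = s ↔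
    (∀ i, HasClusterIComplexityLE Ψ i s) ∧ ∀ s', (∀ i, HasClusterIComplexityLE Ψ i s') → s ≤ s' :=
  leastLevel_eq_coe_iff fun _ _ hab h i => (h i).mono hab

/-- Infinite complexity. [cite: GreenTao2010, Def. 1.5] -/
theorem complexity_eq_top_iff : complexity Ψ = ⊤ ↔ ∀ s, ¬ ∀ i, HasIComplexityLE Ψ i s :=
  leastLevel_eq_top_iff

/-- Infinite cluster complexity. [folklore] -/
theorem clusterComplexity_eq_top_iff :
    clusterComplexity Ψ = ⊤ ↔ ∀ s, ¬ ∀ i, HasClusterIComplexityLE Ψ i s :=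
  leastLevel_eq_top_iff

/-- The cluster complexity never exceeds the complexity. [folklore] -/
theorem clusterComplexity_le_complexity : clusterComplexity Ψ ≤ complexity Ψ :=
  leastLevel_mono fun _ h i => (h i).hasClusterIComplexityLE

/-! ### Cluster gap -/

/-- **Cluster gap at most `B`**: the parallel classes of `Ψ` have internal gaps `≤ B`, i.e.
`|a ψᵢ(0) - b ψⱼ(0)| ≤ B (|a| + |b|)` whenever `a ψ̇ᵢ = b ψ̇ⱼ` with integers `(a, b) ≠ (0, 0)`.
(Twin / prime-tuple / Sophie Germain clusters `(n, n + 2)`, `(n, 2n + 1)`: yes with `B = 1`; the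
Goldbach pair `(n, M - n)` or a shift `(n, n + h)`: only for `M, h ≤ 2B`.) [folklore] -/
def ClusterGapLE (Ψ : Fin t → AffLinForm d) (B : ℕ) : Prop :=
  ∀ i j : Fin t, ∀ a b : ℤ, (a ≠ 0 ∨ b ≠ 0) → a • (Ψ i).coeff = b • (Ψ j).coeff →
    |a * (Ψ i).const - b * (Ψ j).const| ≤ B * (|a| + |b|)

/-- Larger gap bounds are weaker. [folklore] -/
theorem ClusterGapLE.mono {B B' : ℕ} (h : ClusterGapLE Ψ B) (hB : B ≤ B') : ClusterGapLE Ψ B' :=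
  fun i j a b hab heq => (h i j a b hab heq).trans (by gcongr)

/-! ### The two-class rendering of cluster complexity `≤ 1` -/

/-- Cluster-level `i`-complexity `≤ 1` in the two-class form used by route `TwinMinorArcs` of
`Summits/Parity/GeneralizedHardyLittlewood` (target `RankOneClusterGHL`): there is a set `A` of
indices such that, for `S = A` and for `S = Aᶜ`, no NON-ZERO integer multiple of `ψ̇ᵢ` is an
integer combination of the linear parts `ψ̇ⱼ`, `j ∈ S` not parallel to `ψᵢ`. (The decidability
instance is a parameter so that the lemma applies to any rendering of the filter.) [folklore] -/
theorem hasClusterIComplexityLE_one_iff (i : Fin t)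
    [DecidablePred fun j => ∀ a b : ℤ, a • (Ψ j).coeff = b • (Ψ i).coeff → a = 0 ∧ b = 0] :
    HasClusterIComplexityLE Ψ i 1 ↔
      ∃ A : Finset (Fin t), ∀ S : Finset (Fin t), (S = A ∨ S = Aᶜ) →
        ∀ (m : ℤ) (c : Fin t → ℤ), m • (Ψ i).coeff =
          ∑ j ∈ S.filter (fun j => ∀ a b : ℤ, a • (Ψ j).coeff = b • (Ψ i).coeff → a = 0 ∧ b = 0),
            c j • (Ψ j).coeff → m = 0 := by
  classical
  -- the filter predicate is "not parallel to `ψᵢ`"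
  have hnp : ∀ j, (∀ a b : ℤ, a • (Ψ j).coeff = b • (Ψ i).coeff → a = 0 ∧ b = 0) ↔
      ¬ (Ψ i).IsParallel (Ψ j) := fun j =>
    AffLinForm.not_isParallel_iff.symm.trans ⟨fun h h' => h h'.symm, fun h h' => h h'.symm⟩
  constructor
  · rintro ⟨Acl, hcov, hav⟩
    refine ⟨Acl 0, fun S hS m c hmc => ?_⟩
    by_contra hm
    have hsub : ∃ k, S.filter (fun j => ∀ a b : ℤ, a • (Ψ j).coeff = b • (Ψ i).coeff →
        a = 0 ∧ b = 0) ⊆ Acl k := by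
      rcases hS with rfl | rfl
      · exact ⟨0, Finset.filter_subset _ _⟩
      · refine ⟨1, fun j hj => ?_⟩
        obtain ⟨hjA, hj⟩ := Finset.mem_filter.mp hj
        obtain ⟨k, hk⟩ := hcov j ((hnp j).mp hj)
        fin_cases k
        · exact absurd hk (Finset.mem_compl.mp hjA)
        · exact hk
    obtain ⟨k, hk⟩ := hsub
    exact hav k ((memAffLinSpan_iff_exists_int.mpr ⟨m, c, hm, hmc⟩).mono hk)
  · rintro ⟨A, hA⟩
    refine ⟨![A.filter fun j => ∀ a b : ℤ, a • (Ψ j).coeff = b • (Ψ i).coeff → a = 0 ∧ b = 0,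
      Aᶜ.filter fun j => ∀ a b : ℤ, a • (Ψ j).coeff = b • (Ψ i).coeff → a = 0 ∧ b = 0],
      fun j hj => ?_, fun k hk => ?_⟩
    · by_cases hjA : j ∈ A
      · exact ⟨0, by simpa using ⟨hjA, (hnp j).mpr hj⟩⟩
      · exact ⟨1, by simpa using ⟨hjA, (hnp j).mpr hj⟩⟩
    · obtain ⟨m, c, hm, hmc⟩ := memAffLinSpan_iff_exists_int.mp hk
      fin_cases k
      · exact hm (hA A (Or.inl rfl) m c (by simpa using hmc))
      · exact hm (hA Aᶜ (Or.inr rfl) m c (by simpa using hmc))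

/-! ### Lemma 1.6: finite complexity -/

/-- A form is not in the affine-linear span of a single non-parallel form.
[cite: GreenTao2010, proof of Lemma 1.6] -/
theorem not_memAffLinSpan_singleton {j : Fin t}
    (h : ∀ a b : ℤ, a • (Ψ i).coeff = b • (Ψ j).coeff → a = 0 ∧ b = 0) :
    ¬ MemAffLinSpan Ψ i {j} := by
  rw [memAffLinSpan_iff_exists_int]
  rintro ⟨m, c, hm, heq⟩
  rw [Finset.sum_singleton] at heq
  exact hm (h m (c j) heq).1

/-- The singleton cover (Green–Tao, proof of Lemma 1.6): if no two forms are parallel and every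
form is non-constant, then every `i`-complexity is at most `t - 2`.
[cite: GreenTao2010, Lemma 1.6] -/
theorem hasIComplexityLE_of_isFiniteComplexitySystem (hfc : IsFiniteComplexitySystem Ψ)
    (h0 : ∀ i, (Ψ i).coeff ≠ 0) (i : Fin t) : HasIComplexityLE Ψ i (t - 2) := by
  obtain ⟨n, rfl⟩ : ∃ n, t = n + 1 := ⟨t - 1, by have := i.pos; omega⟩
  rcases n with _ | m
  · -- a single form: nothing to cover
    refine ⟨fun _ => ∅, fun j hj => (hj (Fin.ext (by have := j.2; have := i.2; omega))).elim,
      fun _ => ?_⟩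
    rw [memAffLinSpan_empty_iff]
    exact h0 i
  · -- `t = m + 2`: the `m + 1` singletons `{i.succAbove k}`
    refine ⟨fun k => {i.succAbove (k.cast (by omega))}, fun j hj => ?_, fun k => ?_⟩
    · obtain ⟨z, hz⟩ := Fin.exists_succAbove_eq hj
      exact ⟨z.cast (by omega), by simp [← hz]⟩
    · exact not_memAffLinSpan_singleton (hfc i _ (Fin.succAbove_ne i _).symm)

/-- Lemma 1.6, upper bound: a system of finite complexity in the sense of
`IsFiniteComplexitySystem` (with non-constant forms) has complexity at most `t - 2`.
[cite: GreenTao2010, Lemma 1.6] -/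
theorem complexity_le_of_isFiniteComplexitySystem (hfc : IsFiniteComplexitySystem Ψ)
    (h0 : ∀ i, (Ψ i).coeff ≠ 0) : complexity Ψ ≤ (t - 2 : ℕ) :=
  complexity_le_coe_iff.mpr (hasIComplexityLE_of_isFiniteComplexitySystem hfc h0)

/-- Lemma 1.6, converse: a system of complexity `< ∞` has no two parallel forms and no constant
form. [cite: GreenTao2010, Lemma 1.6] -/
theorem isFiniteComplexitySystem_of_complexity_ne_top (h : complexity Ψ ≠ ⊤) :
    IsFiniteComplexitySystem Ψ ∧ ∀ i, (Ψ i).coeff ≠ 0 := by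
  obtain ⟨s, hs⟩ := leastLevel_lt_top_iff.mp (lt_top_iff_ne_top.mpr h)
  have h0 : ∀ i, (Ψ i).coeff ≠ 0 := fun i => (hs i).coeff_ne_zero
  refine ⟨isFiniteComplexitySystem_iff_not_isParallel.mpr fun i j hij => ?_, h0⟩
  exact (hs i).not_isParallel (Ne.symm hij) (h0 j)

/-- **Lemma 1.6** (Green–Tao 2010, first part: "this system has finite complexity if and only if
no two of the `ψᵢ` are affinely dependent"): `complexity Ψ < ∞` iff no two linear parts are
parallel and no form is constant. [cite: GreenTao2010, Lemma 1.6] -/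
theorem complexity_lt_top_iff :
    complexity Ψ < ⊤ ↔ IsFiniteComplexitySystem Ψ ∧ ∀ i, (Ψ i).coeff ≠ 0 := by
  refine ⟨fun h => isFiniteComplexitySystem_of_complexity_ne_top h.ne, fun ⟨hfc, h0⟩ => ?_⟩
  exact (complexity_le_of_isFiniteComplexitySystem hfc h0).trans_lt (ENat.coe_lt_top _)

/-- For `t ≥ 2` forms the non-constancy is part of `IsFiniteComplexitySystem`:
`complexity Ψ < ∞ ↔ IsFiniteComplexitySystem Ψ`. [cite: GreenTao2010, Lemma 1.6] -/
theorem complexity_lt_top_iff_of_two_le (ht : 2 ≤ t) :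
    complexity Ψ < ⊤ ↔ IsFiniteComplexitySystem Ψ := by
  rw [complexity_lt_top_iff, and_iff_left_iff_imp]
  intro hfc i h0
  haveI : Nontrivial (Fin t) := Fin.nontrivial_iff_two_le.mpr ht
  obtain ⟨j, hji⟩ : ∃ j : Fin t, j ≠ i := exists_ne i
  have := (hfc i j hji.symm 1 0 (by simp [h0])).1
  exact one_ne_zero this

/-- Finite complexity: the cluster complexity IS the complexity (nothing is parallel).
[folklore] -/
theorem clusterComplexity_eq_complexity_of_isFiniteComplexitySystem
    (hfc : IsFiniteComplexitySystem Ψ) : clusterComplexity Ψ = complexity Ψ := by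
  refine le_antisymm clusterComplexity_le_complexity (leastLevel_mono fun s h i => ?_)
  refine (h i).anti fun j hji => ?_
  exact isFiniteComplexitySystem_iff_not_isParallel.mp hfc i j (Ne.symm hji)

/-! ### Lemma 1.6, second part: complexity `≤ t - dim Ψ̇` -/

/-- `dim Ψ̇`, the rank of the linear part of the system: the dimension of the `ℚ`-span of the
linear parts `ψ̇₁, …, ψ̇_t` (the rank of the `t × d` coefficient matrix, i.e. the dimension of the
image of `Ψ̇ : ℚ^d → ℚ^t`). [cite: GreenTao2010, Lemma 1.6] -/
def linearRank (Ψ : Fin t → AffLinForm d) : ℕ :=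
  Module.finrank ℚ (Submodule.span ℚ (Set.range fun j : Fin t => fun k => ((Ψ j).coeff k : ℚ)))

/-- Green–Tao's cover from the proof of Lemma 1.6: extend `ψ̇ᵢ` to a basis `{ψ̇ⱼ : j ∈ b}` of the
span of the linear parts chosen among them (`|b| = dim Ψ̇`); the class `{ψⱼ : j ∈ b, j ≠ i}`
together with the `t - dim Ψ̇` singletons `{ψⱼ}`, `j ∉ b`, is an avoiding cover, so the
`i`-complexity is at most `t - dim Ψ̇`. [cite: GreenTao2010, Lemma 1.6] -/
theorem hasIComplexityLE_sub_linearRank (hfc : IsFiniteComplexitySystem Ψ)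
    (h0 : ∀ i, (Ψ i).coeff ≠ 0) (i : Fin t) : HasIComplexityLE Ψ i (t - linearRank Ψ) := by
  classical
  set v : Fin t → Fin d → ℚ := fun j k => ((Ψ j).coeff k : ℚ) with hv
  have hvi : v i ≠ 0 := fun h => h0 i (funext fun k => by
    have : ((Ψ i).coeff k : ℚ) = 0 := by simpa [hv] using congr_fun h k
    exact_mod_cast this)
  obtain ⟨b, -, hib, hTb, hbli⟩ :=
    exists_linearIndepOn_extension (LinearIndepOn.singleton hvi : LinearIndepOn ℚ v {i})
      (Set.subset_univ {i})
  have hib' : i ∈ b := hib rfl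
  set J : Finset (Fin t) := Finset.univ.filter fun j => j ∈ b with hJ
  have hmemJ : ∀ {j}, j ∈ J ↔ j ∈ b := by simp [hJ]
  have hcard : linearRank Ψ = J.card := by
    have hspan : Submodule.span ℚ (Set.range v) =
        Submodule.span ℚ (Set.range fun x : b => v x) := by
      rw [← Set.image_univ, ← Set.image_eq_range]
      exact le_antisymm (Submodule.span_le.mpr hTb)
        (Submodule.span_mono (Set.image_mono (Set.subset_univ b)))
    change Module.finrank ℚ (Submodule.span ℚ (Set.range v)) = _
    rw [hspan, finrank_span_eq_card hbli, Fintype.card_subtype]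
  set O : Finset (Fin t) := Finset.univ.filter fun j => j ∉ b with hO
  have hOcard : O.card = t - linearRank Ψ := by
    have : O = Jᶜ := by
      ext j
      simp [hO, hJ]
    rw [hcard, this, Finset.card_compl, Fintype.card_fin]
  let A : Fin (t - linearRank Ψ + 1) → Finset (Fin t) := fun k =>
    if hk : (k : ℕ) < O.card then {(O.equivFin.symm ⟨k, hk⟩ : Fin t)} else J.erase i
  refine ⟨A, fun j hj => ?_, fun k => ?_⟩
  · by_cases hjb : j ∈ b
    · refine ⟨⟨O.card, by omega⟩, ?_⟩
      dsimp only [A]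
      rw [dif_neg (lt_irrefl _)]
      exact Finset.mem_erase.mpr ⟨hj, hmemJ.mpr hjb⟩
    · have hjO : j ∈ O := by simp [hO, hjb]
      refine ⟨⟨O.equivFin ⟨j, hjO⟩, (O.equivFin ⟨j, hjO⟩).2.trans_le (by omega)⟩, ?_⟩
      dsimp only [A]
      rw [dif_pos (O.equivFin ⟨j, hjO⟩).2]
      simp
  · dsimp only [A]
    split_ifs with hk
    · have hjO : (O.equivFin.symm ⟨k, hk⟩ : Fin t) ∈ O := Finset.coe_mem _
      have hji : i ≠ (O.equivFin.symm ⟨k, hk⟩ : Fin t) := fun h => by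
        have : (O.equivFin.symm ⟨k, hk⟩ : Fin t) ∉ b := (Finset.mem_filter.mp hjO).2
        exact this (h ▸ hib')
      exact not_memAffLinSpan_singleton (hfc _ _ hji)
    · rw [memAffLinSpan_iff_mem_span]
      change v i ∉ Submodule.span ℚ (v '' ↑(J.erase i))
      have : (↑(J.erase i) : Set (Fin t)) = b \ {i} := by
        ext j
        simp [hJ, and_comm]
      rw [this]
      exact hbli.notMem_span hib'

/-- **Lemma 1.6** (Green–Tao 2010, second part: "in this case the complexity of the system is less
than or equal to `t - dim(Ψ̇)`"). [cite: GreenTao2010, Lemma 1.6] -/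
theorem complexity_le_sub_linearRank (hfc : IsFiniteComplexitySystem Ψ)
    (h0 : ∀ i, (Ψ i).coeff ≠ 0) : complexity Ψ ≤ (t - linearRank Ψ : ℕ) :=
  complexity_le_coe_iff.mpr (hasIComplexityLE_sub_linearRank hfc h0)

/-! ### Dimension one -/

/-- In dimension `d = 1` all forms are parallel, so a system of non-constant forms has cluster
complexity `0` (one cluster; the clause is vacuous). [folklore] -/
theorem clusterComplexity_eq_zero_of_dim_one {Ψ : Fin t → AffLinForm 1}
    (h0 : ∀ i, (Ψ i).coeff ≠ 0) : clusterComplexity Ψ = 0 := by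
  refine nonpos_iff_eq_zero.mp ((clusterComplexity_le_coe_iff (s := 0)).mpr fun i => ?_)
  refine ⟨fun _ => ∅, fun j hj => (hj (AffLinForm.isParallel_of_dim_one _ _)).elim, fun _ => ?_⟩
  rw [memAffLinSpan_empty_iff]
  exact h0 i

/-- In dimension `d = 1` any system with `t ≥ 2` forms has infinite complexity ("any system with
`d = 1` and `t > 1` has infinite complexity"). [cite: GreenTao2010, Examples 1] -/
theorem complexity_eq_top_of_dim_one {Ψ : Fin t → AffLinForm 1} (ht : 2 ≤ t) :
    complexity Ψ = ⊤ := by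
  by_contra h
  obtain ⟨hfc, -⟩ := isFiniteComplexitySystem_of_complexity_ne_top h
  haveI : Nontrivial (Fin t) := Fin.nontrivial_iff_two_le.mpr ht
  obtain ⟨j, hj⟩ : ∃ j : Fin t, j ≠ ⟨0, by omega⟩ := exists_ne _
  exact isFiniteComplexitySystem_iff_not_isParallel.mp hfc _ _ hj
    (AffLinForm.isParallel_of_dim_one _ _)

/-! ### Transversals: cluster complexity is the complexity of the cluster configuration -/

namespace AffLinForm

/-- Parallelism passes to proportional forms: if `ψ ∥ ψ'`, `a ψ̇ = b φ̇` and `a' ψ̇' = b' φ̇'` with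
`a, b, a', b' ≠ 0`, then `φ ∥ φ'`. [folklore] -/
theorem IsParallel.of_smul_eq {ψ ψ' φ φ' : AffLinForm d} (h : ψ.IsParallel ψ') {a b a' b' : ℤ}
    (ha : a ≠ 0) (hb : b ≠ 0) (ha' : a' ≠ 0) (hb' : b' ≠ 0) (h1 : a • ψ.coeff = b • φ.coeff)
    (h2 : a' • ψ'.coeff = b' • φ'.coeff) : φ.IsParallel φ' := by
  obtain ⟨x, y, hxy, hpar⟩ := h
  refine ⟨x * a' * b, a * y * b', ?_, ?_⟩
  · rcases hxy with hx | hy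
    · exact Or.inl (mul_ne_zero (mul_ne_zero hx ha') hb)
    · exact Or.inr (mul_ne_zero (mul_ne_zero ha hy) hb')
  · calc (x * a' * b) • φ.coeff = (x * a') • (b • φ.coeff) := by rw [mul_smul]
      _ = (a * a') • (x • ψ.coeff) := by rw [← h1, smul_smul, smul_smul]; congr 1; ring
      _ = (a * y) • (a' • ψ'.coeff) := by rw [hpar, smul_smul, smul_smul]; congr 1; ring
      _ = (a * y * b') • φ'.coeff := by rw [h2, smul_smul]

end AffLinForm

section Labels

variable {r : ℕ} {Φ : Fin r → AffLinForm d} {cl : Fin t → Fin r}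

/-- If every form `ψⱼ` of `Ψ` is proportional (with non-zero integer factors) to the form
`φ_{cl j}` of a second system `Φ` ("one form per cluster", `cl` the cluster label), then
membership in affine-linear spans is read off in `Φ`: `ψᵢ ∈ affspan{ψⱼ : j ∈ C}` iff
`φ_{cl i} ∈ affspan{φ_c : c ∈ cl(C)}` (spans over `ℚ` only see the lines `ℚ ψ̇ⱼ`). [folklore] -/
theorem memAffLinSpan_iff_of_labels
    (hprop : ∀ j, ∃ a b : ℤ, a ≠ 0 ∧ b ≠ 0 ∧ a • (Ψ j).coeff = b • (Φ (cl j)).coeff) :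
    MemAffLinSpan Ψ i C ↔ MemAffLinSpan Φ (cl i) (C.image cl) := by
  classical
  simp only [memAffLinSpan_iff_mem_span]
  set v : Fin t → Fin d → ℚ := fun j k => ((Ψ j).coeff k : ℚ) with hv
  set w : Fin r → Fin d → ℚ := fun c k => ((Φ c).coeff k : ℚ) with hw
  have hq : ∀ j, ∃ q : ℚ, q ≠ 0 ∧ v j = q • w (cl j) := fun j => by
    obtain ⟨a, b, ha, hb, h⟩ := hprop j
    have ha' : (a : ℚ) ≠ 0 := by exact_mod_cast ha
    have hb' : (b : ℚ) ≠ 0 := by exact_mod_cast hb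
    refine ⟨b / a, div_ne_zero hb' ha', funext fun k => ?_⟩
    have hk : ((a * (Ψ j).coeff k : ℤ) : ℚ) = ((b * (Φ (cl j)).coeff k : ℤ) : ℚ) := by
      have := congr_fun h k
      simp only [Pi.smul_apply, smul_eq_mul] at this
      exact_mod_cast this
    push_cast at hk
    simp only [hv, hw, Pi.smul_apply, smul_eq_mul]
    field_simp
    linear_combination hk
  have hspan : Submodule.span ℚ (v '' ↑C) = Submodule.span ℚ (w '' ↑(C.image cl)) := by
    apply le_antisymm
    · refine Submodule.span_le.mpr ?_
      rintro _ ⟨j, hj, rfl⟩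
      obtain ⟨q, -, hvj⟩ := hq j
      rw [hvj]
      refine Submodule.smul_mem _ _ (Submodule.subset_span ⟨cl j, ?_, rfl⟩)
      exact Finset.mem_coe.mpr (Finset.mem_image_of_mem cl (Finset.mem_coe.mp hj))
    · refine Submodule.span_le.mpr ?_
      rintro _ ⟨c, hc, rfl⟩
      obtain ⟨j, hj, rfl⟩ := Finset.mem_image.mp (Finset.mem_coe.mp hc)
      obtain ⟨q, hq0, hvj⟩ := hq j
      have : w (cl j) = q⁻¹ • v j := by rw [hvj, smul_smul, inv_mul_cancel₀ hq0, one_smul]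
      rw [this]
      exact Submodule.smul_mem _ _ (Submodule.subset_span ⟨j, hj, rfl⟩)
  obtain ⟨q, hq0, hvi⟩ := hq i
  change v i ∈ _ ↔ w (cl i) ∈ _
  rw [hspan, hvi]
  exact Submodule.smul_mem_iff _ hq0

/-- Forms with the same label are parallel. [folklore] -/
theorem isParallel_of_labels_eq
    (hprop : ∀ j, ∃ a b : ℤ, a ≠ 0 ∧ b ≠ 0 ∧ a • (Ψ j).coeff = b • (Φ (cl j)).coeff)
    {j j' : Fin t} (h : cl j = cl j') : (Ψ j).IsParallel (Ψ j') := by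
  obtain ⟨a, b, ha, -, h1⟩ := hprop j
  obtain ⟨a', b', -, hb', h2⟩ := hprop j'
  rw [h] at h1
  refine ⟨b' * a, b * a', Or.inl (mul_ne_zero hb' ha), ?_⟩
  rw [mul_smul, h1, mul_smul, h2, smul_comm]

/-- Forms with different labels are not parallel, provided no two forms of `Φ` are parallel.
[folklore] -/
theorem not_isParallel_of_labels_ne
    (hprop : ∀ j, ∃ a b : ℤ, a ≠ 0 ∧ b ≠ 0 ∧ a • (Ψ j).coeff = b • (Φ (cl j)).coeff)
    (hΦ : IsFiniteComplexitySystem Φ) {j j' : Fin t} (h : cl j ≠ cl j') :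
    ¬ (Ψ j).IsParallel (Ψ j') := fun hpar => by
  obtain ⟨a, b, ha, hb, h1⟩ := hprop j
  obtain ⟨a', b', ha', hb', h2⟩ := hprop j'
  exact isFiniteComplexitySystem_iff_not_isParallel.mp hΦ _ _ h
    (hpar.of_smul_eq ha hb ha' hb' h1 h2)

/-- **Cluster complexity via a transversal.** Let the forms of `Ψ` be proportional to the forms
`φ_{cl j}` of a system `Φ` with no two forms parallel, `cl : Fin t → Fin r` onto (so the
parallel classes of `Ψ` are the fibres of `cl`, and `Φ` lists one primitive direction per
cluster). Then the cluster-level `i`-complexity of `Ψ` is the `cl i`-complexity of `Φ`.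
[folklore] -/
theorem hasClusterIComplexityLE_iff_of_labels
    (hprop : ∀ j, ∃ a b : ℤ, a ≠ 0 ∧ b ≠ 0 ∧ a • (Ψ j).coeff = b • (Φ (cl j)).coeff)
    (hΦ : IsFiniteComplexitySystem Φ) (hcl : Function.Surjective cl) :
    HasClusterIComplexityLE Ψ i s ↔ HasIComplexityLE Φ (cl i) s := by
  classical
  constructor
  · rintro ⟨A, hcov, hav⟩
    refine ⟨fun k => (A k).image cl, fun c hc => ?_, fun k h => hav k ?_⟩
    · obtain ⟨j, rfl⟩ := hcl c
      obtain ⟨k, hk⟩ := hcov j (not_isParallel_of_labels_ne hprop hΦ (Ne.symm hc))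
      exact ⟨k, Finset.mem_image_of_mem cl hk⟩
    · exact (memAffLinSpan_iff_of_labels hprop).mpr h
  · rintro ⟨A, hcov, hav⟩
    refine ⟨fun k => Finset.univ.filter fun j => cl j ∈ A k, fun j hj => ?_, fun k h => hav k ?_⟩
    · have hne : cl j ≠ cl i := fun heq => hj (isParallel_of_labels_eq hprop heq.symm)
      obtain ⟨k, hk⟩ := hcov (cl j) hne
      exact ⟨k, by simp [hk]⟩
    · refine ((memAffLinSpan_iff_of_labels hprop).mp h).mono fun c hc => ?_
      obtain ⟨j, hj, rfl⟩ := Finset.mem_image.mp hc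
      simpa using hj

/-- **Cluster complexity = complexity of the cluster configuration**: under the hypotheses of
`hasClusterIComplexityLE_iff_of_labels`, `clusterComplexity Ψ = complexity Φ`. [folklore] -/
theorem clusterComplexity_eq_complexity_of_labels
    (hprop : ∀ j, ∃ a b : ℤ, a ≠ 0 ∧ b ≠ 0 ∧ a • (Ψ j).coeff = b • (Φ (cl j)).coeff)
    (hΦ : IsFiniteComplexitySystem Φ) (hcl : Function.Surjective cl) :
    clusterComplexity Ψ = complexity Φ := by
  unfold clusterComplexity complexity
  congr 1
  funext s
  refine propext ⟨fun h c => ?_,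
    fun h i => (hasClusterIComplexityLE_iff_of_labels hprop hΦ hcl).mpr (h (cl i))⟩
  obtain ⟨i, rfl⟩ := hcl c
  exact (hasClusterIComplexityLE_iff_of_labels hprop hΦ hcl).mp (h i)

end Labels

/-! ### Cluster gaps of shifted systems -/

/-- If a relation `a ψ̇ᵢ = b ψ̇ⱼ` between two forms of `Ψ` with `(a, b) ≠ (0, 0)` forces `a = b`
(all clusters consist of SHIFTS `ψ̇ + h` of one form) and all constants are within `2B` of each
other, then the cluster gap is `≤ B`. [folklore] -/
theorem clusterGapLE_of_consts {B : ℕ}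
    (hab : ∀ i j (a b : ℤ), (a ≠ 0 ∨ b ≠ 0) → a • (Ψ i).coeff = b • (Ψ j).coeff → a = b)
    (hc : ∀ i j, |(Ψ i).const - (Ψ j).const| ≤ 2 * B) : ClusterGapLE Ψ B := by
  intro i j a b h0 heq
  obtain rfl := hab i j a b h0 heq
  rw [← mul_sub, abs_mul]
  calc |a| * |(Ψ i).const - (Ψ j).const| ≤ |a| * (2 * B) := by gcongr; exact hc i j
    _ = B * (|a| + |a|) := by ring

/-- The shift pair `n ↦ (n, n + h)` (`d = 1`, `t = 2`); `twinPrimeSystem = shiftPairSystem 2`.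
[cite: GreenTao2010, Example 1] -/
def shiftPairSystem (h : ℤ) : Fin 2 → AffLinForm 1 := ![⟨![1], 0⟩, ⟨![1], h⟩]

/-- The twin-prime system is the shift pair with `h = 2`. [cite: GreenTao2010, Example 1] -/
theorem twinPrimeSystem_eq_shiftPairSystem : twinPrimeSystem = shiftPairSystem 2 := rfl

/-- The shift pair `(n, n + h)` has cluster gap `≤ B` iff `|h| ≤ 2B` (twins: `B = 1`; a large
shift `h` is excluded by any fixed `B`). [folklore] -/
theorem clusterGapLE_shiftPairSystem_iff {h : ℤ} {B : ℕ} :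
    ClusterGapLE (shiftPairSystem h) B ↔ |h| ≤ 2 * B := by
  constructor
  · intro hg
    have := hg 0 1 1 1 (Or.inl one_ne_zero) rfl
    simp only [shiftPairSystem, Matrix.cons_val_zero, Matrix.cons_val_one] at this
    have h2 : |h| ≤ (B : ℤ) * 2 := by simpa [abs_one, one_add_one_eq_two] using this
    linarith
  · intro hB
    refine clusterGapLE_of_consts (fun i j a b _ heq => ?_) (fun i j => ?_)
    · have := congr_fun heq 0
      fin_cases i <;> fin_cases j <;> simpa [shiftPairSystem] using this
    · fin_cases i <;> fin_cases j <;> simp [shiftPairSystem, abs_neg, hB]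

/-- Twin primes: cluster gap `≤ 1`. [folklore] -/
theorem clusterGapLE_twinPrimeSystem : ClusterGapLE twinPrimeSystem 1 := by
  rw [twinPrimeSystem_eq_shiftPairSystem, clusterGapLE_shiftPairSystem_iff]
  norm_num

/-- The Goldbach pair `n ↦ (n, M - n)` (`d = 1`, `t = 2`). [cite: GreenTao2010, Example 1] -/
def goldbachSystem (M : ℤ) : Fin 2 → AffLinForm 1 := ![⟨![1], 0⟩, ⟨![-1], M⟩]

/-- The Goldbach pair `(n, M - n)` has cluster gap `> B` as soon as `|M| > 2B`: take
`(a, b) = (1, -1)`. [folklore] -/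
theorem not_clusterGapLE_goldbachSystem {M : ℤ} {B : ℕ} (hM : 2 * (B : ℤ) < |M|) :
    ¬ ClusterGapLE (goldbachSystem M) B := fun hg => by
  have := hg 0 1 1 (-1) (Or.inl one_ne_zero) (by ext k; fin_cases k; simp [goldbachSystem])
  simp only [goldbachSystem, Matrix.cons_val_zero, Matrix.cons_val_one] at this
  simp [abs_one] at this
  linarith

/-! ### Normal form implies bounded complexity (Green–Tao 2010, §4) -/

/-- "If a system is in `s`-normal form, then … for each `i ∈ [t]` the `i`-complexity of the system
is at most `s`": the class attached to `e ∈ Jᵢ` is `{ψ_{i'} : ψ̇_{i'}(e) = 0}`, and `e` itself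
witnesses that `ψᵢ` is not in its affine-linear span. (Non-constancy of the forms is needed
only in the degenerate case `t = 1`, `Jᵢ = ∅`.) [cite: GreenTao2010, §4 (after Def. 4.2)] -/
theorem hasIComplexityLE_of_isNormalForm (h : IsNormalForm s Ψ) (h0 : ∀ i, (Ψ i).coeff ≠ 0)
    (i : Fin t) : HasIComplexityLE Ψ i s := by
  classical
  obtain ⟨J, hJ, hprod, hvan⟩ := h i
  set cls : Fin d → Finset (Fin t) := fun e => Finset.univ.filter fun i' => (Ψ i').coeff e = 0
    with hcls
  have havoid : ∀ e ∈ J, ¬ MemAffLinSpan Ψ i (cls e) := fun e he => by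
    refine not_memAffLinSpan_of_witness (Pi.single e 1) (fun j hj => ?_) ?_
    · rw [AffLinForm.linearPart_single]
      simpa [hcls] using hj
    · rw [AffLinForm.linearPart_single]
      exact Finset.prod_ne_zero_iff.mp hprod e he
  rcases J.eq_empty_or_nonempty with hJe | ⟨e₀, he₀⟩
  · refine ⟨fun _ => ∅, fun j hj => absurd (hvan j hj) (by simp [hJe]), fun _ => ?_⟩
    rw [memAffLinSpan_empty_iff]
    exact h0 i
  · let enum : Fin (s + 1) → Fin d := fun k =>
      if hk : (k : ℕ) < J.card then (J.equivFin.symm ⟨k, hk⟩ : Fin d) else e₀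
    have henum : ∀ k, enum k ∈ J := fun k => by
      dsimp only [enum]
      split_ifs
      · exact Finset.coe_mem _
      · exact he₀
    refine ⟨fun k => cls (enum k), fun j hj => ?_, fun k => havoid _ (henum k)⟩
    obtain ⟨e, he, hje⟩ := Finset.prod_eq_zero_iff.mp (hvan j hj)
    have hlt : ((J.equivFin ⟨e, he⟩ : Fin J.card) : ℕ) < s + 1 :=
      lt_of_lt_of_le (J.equivFin ⟨e, he⟩).2 hJ
    refine ⟨⟨_, hlt⟩, ?_⟩
    have : enum ⟨_, hlt⟩ = e := by
      dsimp only [enum]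
      rw [dif_pos (J.equivFin ⟨e, he⟩).2]
      simp
    simpa [this, hcls] using hje

/-- A system of non-constant forms in `s`-normal form has complexity `≤ s`.
[cite: GreenTao2010, §4 (after Def. 4.2)] -/
theorem complexity_le_of_isNormalForm (h : IsNormalForm s Ψ) (h0 : ∀ i, (Ψ i).coeff ≠ 0) :
    complexity Ψ ≤ s :=
  complexity_le_coe_iff.mpr (hasIComplexityLE_of_isNormalForm h h0)

/-! ### Examples (Green–Tao 2010, Examples 1) and the route's test systems -/

/-- Arithmetic progressions: no two of the linear parts `(1, i)` of the system
`(n₁, n₁ + n₂, …, n₁ + (k-1) n₂)` (`= Literature.Barriers.Parity.apSystem k`, definitionally)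
are parallel. [cite: GreenTao2010, Examples 1] -/
theorem isFiniteComplexitySystem_arithProg (k : ℕ) :
    IsFiniteComplexitySystem (fun i : Fin k => (⟨![1, (i : ℤ)], 0⟩ : AffLinForm 2)) := by
  intro i j hij a b hab
  have h0 := congr_fun hab 0
  have h1 := congr_fun hab 1
  simp only [Pi.smul_apply, Matrix.cons_val_zero, Matrix.cons_val_one, smul_eq_mul, mul_one]
    at h0 h1
  subst h0
  have hij' : ((i : ℕ) : ℤ) ≠ ((j : ℕ) : ℤ) := by exact_mod_cast Fin.val_ne_of_ne hij
  have ha : a = 0 := by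
    by_contra ha
    exact hij' (mul_left_cancel₀ ha (by exact_mod_cast h1))
  exact ⟨ha, ha⟩

/-- **`k`-term progressions have complexity `k - 2`** (Green–Tao 2010, Examples 1: "because each
form does not lie in the affine span of any other individual form, though it is in the affine
span of any two other forms"), stated for `k + 2` forms: the system
`(n₁, n₁ + n₂, …, n₁ + (k+1) n₂)` (`= Literature.Barriers.Parity.apSystem (k+2)`) has complexity
exactly `k`. [cite: GreenTao2010, Examples 1] -/
theorem complexity_arithProg (k : ℕ) :
    complexity (fun i : Fin (k + 2) => (⟨![1, (i : ℤ)], 0⟩ : AffLinForm 2)) = k := by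
  refine complexity_eq_coe_iff.mpr ⟨fun i => ?_, fun s' hs' => ?_⟩
  · simpa using hasIComplexityLE_of_isFiniteComplexitySystem
      (isFiniteComplexitySystem_arithProg (k + 2)) (fun i => by simp) i
  · by_contra hlt
    push Not at hlt
    -- at `i = 0`: the other `k + 1` forms, any two of which have `ψ₀` in their affine span
    have hle : s' + 2 ≤ k + 2 := by omega
    refine not_hasAvoidingCover_of_pairs (Ψ := fun i : Fin (k + 2) => (⟨![1, (i : ℤ)], 0⟩ :
        AffLinForm 2)) (i := 0) (fun a => (Fin.castLE (by omega) a : Fin (k + 1)).succ)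
      (fun a => Fin.succ_ne_zero _) (fun a b hab => ?_) (hs' 0)
    set u : ℤ := (((Fin.castLE (by omega) a : Fin (k + 1)).succ : ℕ) : ℤ) with hu
    set v : ℤ := (((Fin.castLE (by omega) b : Fin (k + 1)).succ : ℕ) : ℤ) with hv
    have huv : v - u ≠ 0 := by
      have : (a : ℕ) ≠ b := fun h => hab (Fin.ext h)
      simp only [hu, hv, Fin.val_succ, Fin.val_castLE]
      omega
    have hne : (Fin.castLE (by omega) a : Fin (k + 1)).succ
        ≠ (Fin.castLE (by omega) b : Fin (k + 1)).succ := fun h =>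
      hab (Fin.castLE_injective _ (Fin.succ_injective _ h))
    classical
    refine memAffLinSpan_iff_exists_int.mpr ⟨v - u,
      fun j => if j = (Fin.castLE (by omega) a : Fin (k + 1)).succ then v else -u, huv, ?_⟩
    simp only [Finset.sum_pair hne, Ne.symm hne, if_true, if_false]
    ext l
    fin_cases l <;> simp [hu, hv] <;> ring

/-- Twin primes `(n, n + 2)`: infinite complexity (two parallel forms).
[cite: GreenTao2010, Examples 1] -/
theorem complexity_twinPrimeSystem : complexity twinPrimeSystem = ⊤ :=
  complexity_eq_top_of_dim_one le_rfl

/-- Twin primes `(n, n + 2)`: ONE cluster, cluster complexity `0`. [folklore] -/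
theorem clusterComplexity_twinPrimeSystem : clusterComplexity twinPrimeSystem = 0 :=
  clusterComplexity_eq_zero_of_dim_one fun i => by fin_cases i <;> simp [twinPrimeSystem]

/-- The Schur / corner configuration `(n₁, n₂, n₁ + n₂)` on `ℤ²`. [cite: GreenTao2010, Examples 1] -/
def schurSystem : Fin 3 → AffLinForm 2 := ![⟨![1, 0], 0⟩, ⟨![0, 1], 0⟩, ⟨![1, 1], 0⟩]

/-- No two forms of `(n₁, n₂, n₁ + n₂)` are parallel, and none is constant.
[cite: GreenTao2010, Examples 1] -/
theorem isFiniteComplexitySystem_schurSystem :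
    IsFiniteComplexitySystem schurSystem ∧ ∀ i, (schurSystem i).coeff ≠ 0 := by
  refine ⟨fun i j hij a b hab => ?_, fun i => by fin_cases i <;> simp [schurSystem]⟩
  have h0 := congr_fun hab 0
  have h1 := congr_fun hab 1
  fin_cases i <;> fin_cases j <;> simp [schurSystem] at hij h0 h1 ⊢ <;> omega

/-- `(n₁, n₂, n₁ + n₂)` has complexity exactly `1` (as Green–Tao's `(n₁, n₂, N - n₁ - n₂)`):
`≤ 1` by the singleton cover, `≥ 1` since `n₁ = (n₁ + n₂) - n₂` lies in the affine span of the
other two forms. [cite: GreenTao2010, Examples 1] -/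
theorem complexity_schurSystem : complexity schurSystem = 1 := by
  rw [show (1 : ℕ∞) = ((1 : ℕ) : ℕ∞) from rfl]
  refine complexity_eq_coe_iff.mpr ⟨?_, fun s' hs' => ?_⟩
  · simpa using hasIComplexityLE_of_isFiniteComplexitySystem
      isFiniteComplexitySystem_schurSystem.1 isFiniteComplexitySystem_schurSystem.2
  by_contra hlt
  obtain rfl : s' = 0 := by omega
  refine not_hasAvoidingCover_of_pairs (Ψ := schurSystem) (i := 0) ![1, 2]
    (fun a => by fin_cases a <;> decide) (fun a b hab => ?_) (hs' 0)
  have key : MemAffLinSpan schurSystem 0 {1, 2} := by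
    classical
    refine memAffLinSpan_iff_exists_int.mpr ⟨1, ![0, -1, 1], one_ne_zero, ?_⟩
    rw [Finset.sum_pair (by decide)]
    ext l; fin_cases l <;> simp [schurSystem]
  fin_cases a <;> fin_cases b <;> simp at hab ⊢
  · exact key
  · rw [Finset.pair_comm]; exact key

/-- The route's CORNER SYSTEM `(n₁, n₁ + 2, n₂, n₂ + 2, n₁ + n₂, n₁ + n₂ + 2)` on `ℤ²` (twin pairs
at `n₁`, `n₂` and `n₁ + n₂`): three clusters in the configuration `schurSystem`. [folklore] -/
def cornerSystem : Fin 6 → AffLinForm 2 :=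
  ![⟨![1, 0], 0⟩, ⟨![1, 0], 2⟩, ⟨![0, 1], 0⟩, ⟨![0, 1], 2⟩, ⟨![1, 1], 0⟩, ⟨![1, 1], 2⟩]

/-- Cluster labels of the corner system: form `j` is a shift of `schurSystem (j / 2)`.
[folklore] -/
def cornerLabel : Fin 6 → Fin 3 := fun j => ⟨(j : ℕ) / 2, by omega⟩

/-- The corner system is `schurSystem ∘ cornerLabel` up to the shifts `0, 2`. [folklore] -/
theorem cornerSystem_coeff (j : Fin 6) :
    (cornerSystem j).coeff = (schurSystem (cornerLabel j)).coeff := by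
  fin_cases j <;> rfl

/-- The corner system has cluster complexity exactly `1`. [folklore] -/
theorem clusterComplexity_cornerSystem : clusterComplexity cornerSystem = 1 := by
  rw [← complexity_schurSystem]
  refine clusterComplexity_eq_complexity_of_labels (cl := cornerLabel)
    (fun j => ⟨1, 1, one_ne_zero, one_ne_zero, by rw [cornerSystem_coeff]⟩)
    isFiniteComplexitySystem_schurSystem.1 fun c => ⟨⟨2 * (c : ℕ), by omega⟩, Fin.ext ?_⟩
  simp [cornerLabel]

/-- The corner system has cluster gap `≤ 1` (all clusters are twin pairs). [folklore] -/
theorem clusterGapLE_cornerSystem : ClusterGapLE cornerSystem 1 := by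
  refine clusterGapLE_of_consts (fun i j a b h0 heq => ?_) (fun i j => ?_)
  · have e0 := congr_fun heq 0
    have e1 := congr_fun heq 1
    fin_cases i <;> fin_cases j <;> simp [cornerSystem] at e0 e1 <;> omega
  · fin_cases i <;> fin_cases j <;> simp [cornerSystem]

/-- The corner system itself has infinite complexity (it contains parallel pairs).
[cite: GreenTao2010, Lemma 1.6] -/
theorem complexity_cornerSystem : complexity cornerSystem = ⊤ := by
  by_contra h
  have := (isFiniteComplexitySystem_of_complexity_ne_top h).1 0 1 (by decide) 1 1 rfl
  exact one_ne_zero this.1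

/-- FOUR-TERM PROGRESSIONS OF TWINS: the system `fourAPSystem × {0, 2}`, i.e.
`(x, x + 2, x + y, x + y + 2, x + 2y, x + 2y + 2, x + 3y, x + 3y + 2)` on `ℤ²`: four clusters in
the configuration `(x, x + y, x + 2y, x + 3y)`. [folklore] -/
def fourAPTwinSystem : Fin 8 → AffLinForm 2 :=
  ![⟨![1, 0], 0⟩, ⟨![1, 0], 2⟩, ⟨![1, 1], 0⟩, ⟨![1, 1], 2⟩,
    ⟨![1, 2], 0⟩, ⟨![1, 2], 2⟩, ⟨![1, 3], 0⟩, ⟨![1, 3], 2⟩]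

/-- Cluster labels of `fourAPTwinSystem`: form `j` is a shift of `x + (j / 2) y`. [folklore] -/
def fourAPTwinLabel : Fin 8 → Fin 4 := fun j => ⟨(j : ℕ) / 2, by omega⟩

/-- `fourAPTwinSystem` is the `4`-AP system on its labels up to the shifts `0, 2`. [folklore] -/
theorem fourAPTwinSystem_coeff (j : Fin 8) :
    (fourAPTwinSystem j).coeff =
      ((fun i : Fin 4 => (⟨![1, (i : ℤ)], 0⟩ : AffLinForm 2)) (fourAPTwinLabel j)).coeff := by
  fin_cases j <;> rfl

/-- Four-term progressions of twins have cluster complexity exactly `2` (the complexity of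
`(x, x + y, x + 2y, x + 3y)`), hence lie outside the rank-one cluster family. [folklore] -/
theorem clusterComplexity_fourAPTwinSystem : clusterComplexity fourAPTwinSystem = 2 := by
  rw [show (2 : ℕ∞) = ((2 : ℕ) : ℕ∞) from rfl, ← complexity_arithProg 2]
  refine clusterComplexity_eq_complexity_of_labels (cl := fourAPTwinLabel)
    (fun j => ⟨1, 1, one_ne_zero, one_ne_zero, by rw [fourAPTwinSystem_coeff]⟩)
    (isFiniteComplexitySystem_arithProg 4) fun c => ⟨⟨2 * (c : ℕ), by omega⟩, Fin.ext ?_⟩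
  simp [fourAPTwinLabel]

end Literature.NumberTheory.Sieve
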